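import Mathlib
import Summits.CriticalPhenomena.PercolationContinuityZ3.Theorems.PercNearOneGluingNoHeavyLowerTailIndicatorLawDefs
import Summits.CriticalPhenomena.PercolationContinuityZ3.Theorems.PercNearOneGluingNoHeavyLowerTailIndicatorLawFakeLaw
import Summits.CriticalPhenomena.PercolationContinuityZ3.Theses.PercNearOneGluing
import Summits.CriticalPhenomena.PercolationContinuityZ3.Theses.PercNearOneGluingNoHeavy
import Literature.Probability.LatticeModels.ProdBernoulliIndependence
import Literature.Probability.Percolation.PercolationEvents
import Literature.Probability.Percolation.PercolationProofs
import HarnessLib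

/-!
# Crux `NoHeavyLowerTail` (stmt-CriticalPhenomena-4575), line `one-cut-entropy-shearer` — NO-GO for indicator-law arguments

Route-task nh7-entropy (2026-08-18); definitions in `…IndicatorLawDefs.lean` (p177006), witness facts in
`…IndicatorLawFakeLaw.lean`.  The crux
`Summit.CriticalPhenomena.PercolationContinuityZ3.Theses.PercNearOneGluing.NoHeavyLowerTail` (≡ Kozma–Nitzan Conjecture 3;
shared with the sibling route `PercNearOneGluingNoHeavy`) concerns the law of the random relay set `S = {a ∈ A : o ↔ a}`.
Line (iv) of the one-cut programme proposed to bound the bad lower-tail mass `P(1 ≤ |S| < ρ E|S|)` by an entropy / Shearer /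
Han-type inequality over the PAIR MARGINALS of the indicator vector `(1_{o↔a})_{a∈A}`, using positive association where needed.
Typed, such an argument proves the abstract principle `IndicatorLawLowerTail C ρ` for some `C` and some `ρ > 0`.  This file shows:

* `noHeavyLowerTail_of_indicatorLawLowerTail` — the principle WOULD close the crux: the law `relayLaw` of `S` under
  `prodBernoulli w` is positively associated (Harris, `prodBernoulli_harris`, pushed forward along the increasing map
  `relaySet`), `p(S = ∅) = P(o ↮ A)`, pair discordance `≤ P(a ↮ a')`, mean `= Σ_a P(o ↔ a) = E N`;
* `not_indicatorLawLowerTail`, `not_indicatorLawLowerTailED` — the principle is FALSE for every `C` and every `ρ > 0`, and so is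
  its ε–δ form (the literal shape of the crux; `noHeavyLowerTail_of_indicatorLawLowerTailED` is the δ-for-δ reduction).  Witness: `fakeLaw k q =
  ½ δ_⊤ + ½ Ber(q)^{⊗k}` with `k = r²`, `q = 1/r` (positively associated by FKG, `isPosAssocLaw_fakeLaw`): `p(∅) ≤ 1/r`, pair
  discordance `≤ 1/r`, but `p(1 ≤ N < ρ m) > 1/4` once `r > 4C` and `r > 4/ρ + 2` ("`o` glued to everything, or to a sparse
  independent sprinkle of the relays").

Consequence (the verdict on the line): no argument whose only inputs are universally valid inequalities on the joint law of the
connection indicators (entropy/Shearer/Han, union bounds, moments of `N`), positive association of that law, and the two scalar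
hypotheses `P(N = 0) ≤ t`, `P(1_{o↔a} ≠ 1_{o↔a'}) ≤ t` can prove the crux, let alone the one-cut engine `stub_oneCut`; the sparse
regime `1 ≤ N ≤ ck` needs structure beyond the indicator law (in the tree: BHK cluster-conditional association under a common
separated event, `nhlt_singleFingerHub`; the dense regime is hypothesis-free, `nhlt_pairProjection`).  This complements the
terminal-events no-go "Theorem N" (docs/m5/OVERLAP-KN-QUOTES.md, row 3: FKG+BHK on terminal events cannot prove the EXACT `|A| = 3`
inequality) with a kernel-checked statement about the ε–δ form UNIFORM in `|A|`.
-/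

noncomputable section

namespace Summit.CriticalPhenomena.PercolationContinuityZ3.Theorems

open Finset MeasureTheory
open Literature.Probability.LatticeModels (prodBernoulli prodBernoulli_harris)
open Literature.Probability.Percolation (openConn openGraph isUpperSet_openConn measurableSet_openConn_holds)
open scoped BigOperators Classical

/-! ## The principle is false -/

/-- **No-go.**  For every `C` and every `ρ > 0` the abstract indicator-law lower-tail principle
fails: the law `½ δ_⊤ + ½ Ber(1/r)^{⊗ r²}` on `Finset (Fin r²)` is positively associated (it is
log-supermodular, so Mathlib's `fkg` applies), has `p(∅) ≤ 1/r`, pair discordance `≤ 1/r`, mean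
`m ≥ r²/2`, and bad mass `p(1 ≤ N < ρ m) ≥ 1/4`, for `r` large in terms of `C, ρ`. [this file] -/
theorem not_indicatorLawLowerTail (C ρ : ℝ) (hρ : 0 < ρ) : ¬ IndicatorLawLowerTail C ρ := by
  intro h
  -- the size parameter
  set r : ℕ := ⌈4 * C⌉₊ + ⌈4 / ρ⌉₊ + 3 with hr
  have hrC : 4 * C < r := by
    rw [hr]; push_cast
    linarith [Nat.le_ceil (4 * C), (Nat.cast_nonneg (⌈4 / ρ⌉₊) : (0:ℝ) ≤ _)]
  have hrρ : 4 / ρ + 2 < r := by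
    rw [hr]; push_cast
    have : 0 ≤ (⌈4 * C⌉₊ : ℝ) := Nat.cast_nonneg _
    linarith [Nat.le_ceil (4 / ρ)]
  have hρ4 : 0 < 4 / ρ := by positivity
  have hrpos : (0 : ℝ) < r := by linarith
  have hr1 : (1 : ℝ) ≤ r := by linarith
  set k : ℕ := r ^ 2 with hk
  have hrn : 1 ≤ r := by exact_mod_cast hr1
  have hk1 : 1 ≤ k := by rw [hk]; exact Nat.one_le_pow _ _ hrn
  have hkr : (k : ℝ) = r ^ 2 := by rw [hk]; push_cast; ring
  set q : ℝ := 1 / r with hq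
  have hq0 : 0 ≤ q := by rw [hq]; positivity
  have hq1 : q ≤ 1 := by rw [hq, div_le_one hrpos]; exact hr1
  have hkq : (k : ℝ) * q = r := by rw [hkr, hq]; field_simp
  -- the threshold
  set m : ℝ := ∑ i : Fin k, ∑ u with i ∈ u, fakeLaw k q u with hm
  have hm_ge : (k : ℝ) / 2 ≤ m := fakeLaw_mean_ge hq0 hq1
  have hkpos : (0 : ℝ) < k := by rw [hkr]; positivity
  have hθ : 0 < ρ * m := mul_pos hρ (lt_of_lt_of_le (by linarith) hm_ge)
  -- apply the principle to the fake law with `t = q = 1/r`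
  have hreach : fakeLaw k q ∅ ≤ q := by
    refine (fakeLaw_empty_le hk1 hq0 hq1).trans ?_
    have h1 : 1 / (1 + (r : ℝ)) ≤ 1 / r := one_div_le_one_div_of_le hrpos (by linarith)
    have h2 : 0 ≤ 1 / (1 + (r : ℝ)) := by positivity
    rw [hkq, hq]
    linarith
  have key : (∑ s with (1 ≤ s.card ∧ (s.card : ℝ) < ρ * m), fakeLaw k q s) ≤ C * q :=
    h (Fin k) (fakeLaw k q) (isPosAssocLaw_fakeLaw hq0 hq1) (sum_fakeLaw q) q hq0 hreach
      (fun i j _ => fakeLaw_pair_le hq0 hq1 i j)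
  have hbad := fakeLaw_bad_ge (k := k) hq0 hq1 hθ
  -- numeric contradiction: bad mass ≥ 1/4 > C q
  have h1 : 1 / (1 + (k : ℝ) * q) ≤ 1 / r := by
    rw [hkq]; exact one_div_le_one_div_of_le hrpos (by linarith)
  have h2 : (k : ℝ) * q / (ρ * m) ≤ 2 / (ρ * r) := by
    rw [hkq, div_le_div_iff₀ hθ (by positivity)]
    have : ρ * ((k : ℝ) / 2) ≤ ρ * m := mul_le_mul_of_nonneg_left hm_ge hρ.le
    rw [hkr] at this
    nlinarith
  have h3 : 1 / (r : ℝ) + 2 / (ρ * r) < 1 / 2 := by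
    have e : 1 / (r : ℝ) + 2 / (ρ * r) = (1 + 2 / ρ) / r := by field_simp
    rw [e, div_lt_iff₀ hrpos]
    have e2 : (4 : ℝ) / ρ = 2 * (2 / ρ) := by ring
    rw [e2] at hrρ
    linarith
  have h4 : C * q < 1 / 4 := by
    rw [hq, show C * (1 / (r : ℝ)) = C / r by ring, div_lt_iff₀ hrpos]
    linarith
  linarith

/-- **No-go, ε–δ form.**  Even the ε–δ principle `IndicatorLawLowerTailED` (the literal shape of the crux, transported to abstract
positively associated indicator laws) is false: at `ε = 1/4`, whatever `δ > 0` is offered, the witness `fakeLaw (r²) (1/r)` with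
`r = ⌈1/δ⌉ + ⌈1/δ⌉ + 3` (so that `1/r ≤ δ` and `r > 4/(4δ) + 2`) has `p(∅) ≤ δ`, pair discordance `≤ δ` and bad mass (threshold
`δ·m/ε = 4δ·m`) `> 1/4`. [this file] -/
theorem not_indicatorLawLowerTailED : ¬ IndicatorLawLowerTailED := by
  intro h
  obtain ⟨δ, hδ, hP⟩ := h (1 / 4) (by norm_num)
  set ρ : ℝ := 4 * δ with hρdef
  have hρ : 0 < ρ := by positivity
  -- the size parameter
  set r : ℕ := ⌈1 / δ⌉₊ + ⌈4 / ρ⌉₊ + 3 with hr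
  have hrδ : 1 / δ < r := by
    rw [hr]; push_cast
    have : 0 ≤ (⌈4 / ρ⌉₊ : ℝ) := Nat.cast_nonneg _
    linarith [Nat.le_ceil (1 / δ)]
  have hrρ : 4 / ρ + 2 < r := by
    rw [hr]; push_cast
    have : 0 ≤ (⌈1 / δ⌉₊ : ℝ) := Nat.cast_nonneg _
    linarith [Nat.le_ceil (4 / ρ)]
  have hρ4 : 0 < 4 / ρ := by positivity
  have hrpos : (0 : ℝ) < r := by linarith
  have hr1 : (1 : ℝ) ≤ r := by linarith
  set k : ℕ := r ^ 2 with hk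
  have hrn : 1 ≤ r := by exact_mod_cast hr1
  have hk1 : 1 ≤ k := by rw [hk]; exact Nat.one_le_pow _ _ hrn
  have hkr : (k : ℝ) = r ^ 2 := by rw [hk]; push_cast; ring
  set q : ℝ := 1 / r with hq
  have hq0 : 0 ≤ q := by rw [hq]; positivity
  have hq1 : q ≤ 1 := by rw [hq, div_le_one hrpos]; exact hr1
  have hkq : (k : ℝ) * q = r := by rw [hkr, hq]; field_simp
  have hqδ : q ≤ δ := by
    rw [hq]
    have h1 : 1 / (r : ℝ) < 1 / (1 / δ) := one_div_lt_one_div_of_lt (by positivity) hrδ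
    rw [one_div_one_div] at h1
    exact h1.le
  -- the threshold
  set m : ℝ := ∑ i : Fin k, ∑ u with i ∈ u, fakeLaw k q u with hm
  have hm_ge : (k : ℝ) / 2 ≤ m := fakeLaw_mean_ge hq0 hq1
  have hkpos : (0 : ℝ) < k := by rw [hkr]; positivity
  have hmpos : 0 < m := lt_of_lt_of_le (by linarith) hm_ge
  have hθ : 0 < δ * m / (1 / 4) := div_pos (mul_pos hδ hmpos) (by norm_num)
  have hθρ : δ * m / (1 / 4) = ρ * m := by rw [hρdef]; ring
  -- apply the principle to the fake law
  have hreach : fakeLaw k q ∅ ≤ δ := by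
    refine (fakeLaw_empty_le hk1 hq0 hq1).trans (le_trans ?_ hqδ)
    have h1 : 1 / (1 + (r : ℝ)) ≤ 1 / r := one_div_le_one_div_of_le hrpos (by linarith)
    have h2 : 0 ≤ 1 / (1 + (r : ℝ)) := by positivity
    rw [hkq, hq]
    linarith
  have key : (∑ s with (1 ≤ s.card ∧ (s.card : ℝ) < δ * m / (1 / 4)), fakeLaw k q s) < 1 / 4 :=
    hP (Fin k) (fakeLaw k q) (isPosAssocLaw_fakeLaw hq0 hq1) (sum_fakeLaw q) hreach
      (fun i j _ => (fakeLaw_pair_le hq0 hq1 i j).trans hqδ)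
  have hbad := fakeLaw_bad_ge (k := k) hq0 hq1 hθ
  -- numeric contradiction: bad mass > 1/4
  have h1 : 1 / (1 + (k : ℝ) * q) ≤ 1 / r := by
    rw [hkq]; exact one_div_le_one_div_of_le hrpos (by linarith)
  have h2 : (k : ℝ) * q / (δ * m / (1 / 4)) ≤ 2 / (ρ * r) := by
    rw [hθρ, hkq, div_le_div_iff₀ (mul_pos hρ hmpos) (by positivity)]
    have : ρ * ((k : ℝ) / 2) ≤ ρ * m := mul_le_mul_of_nonneg_left hm_ge hρ.le
    rw [hkr] at this
    nlinarith
  have h3 : 1 / (r : ℝ) + 2 / (ρ * r) < 1 / 2 := by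
    have e : 1 / (r : ℝ) + 2 / (ρ * r) = (1 + 2 / ρ) / r := by field_simp
    rw [e, div_lt_iff₀ hrpos]
    have e2 : (4 : ℝ) / ρ = 2 * (2 / ρ) := by ring
    rw [e2] at hrρ
    linarith
  linarith


/-! ## The percolation indicator law satisfies the hypotheses of the principle -/

section Perc

variable {n : ℕ} (w : Sym2 (Fin n) → unitInterval) (A : Finset (Fin n)) (o : Fin n)

/-- Membership in the relay set is connection to the observer. -/
theorem mem_relaySet (ω : Set (Sym2 (Fin n))) (a : A) :
    a ∈ relaySet A o ω ↔ ω ∈ openConn o (a : Fin n) := by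
  simp [relaySet]

/-- The relay set is increasing in the configuration. -/
theorem relaySet_mono : Monotone (relaySet A o) := by
  intro ω ω' h a ha
  rw [mem_relaySet] at ha ⊢
  exact isUpperSet_openConn _ _ h ha

/-- Fibre sums are event masses. -/
theorem sum_relayLaw_eq (P : Finset A → Prop) [DecidablePred P] :
    ∑ s with P s, relayLaw w A o s = (prodBernoulli w).real {ω | P (relaySet A o ω)} := by
  have hset : {ω | P (relaySet A o ω)} = ⋃ s ∈ (univ.filter fun s : Finset A => P s), relaySet A o ⁻¹' {s} := by
    ext ω
    simp only [Set.mem_setOf_eq, Set.mem_iUnion, Set.mem_preimage, Set.mem_singleton_iff, Finset.mem_filter,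
      Finset.mem_univ, true_and, exists_prop, exists_eq_right']
  rw [hset, measureReal_biUnion_finset]
  · rfl
  · intro s _ t _ hst
    exact Set.disjoint_iff.2 fun ω ⟨h1, h2⟩ => hst (h1.symm.trans h2)
  · intro s _
    exact MeasurableSet.of_discrete

/-- The relay law is nonnegative. -/
theorem relayLaw_nonneg (s : Finset A) : 0 ≤ relayLaw w A o s := measureReal_nonneg

/-- The relay law has total mass `1`. -/
theorem sum_relayLaw_univ : ∑ s, relayLaw w A o s = 1 := by
  have h := sum_relayLaw_eq w A o (fun _ => True)
  rw [Finset.filter_true_of_mem (fun _ _ => trivial)] at h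
  rw [h]
  simp

/-- The relay law is positively associated (Harris' inequality transported along the increasing map
`relaySet`). -/
theorem isPosAssocLaw_relayLaw : IsPosAssocLaw (relayLaw w A o) := by
  refine ⟨relayLaw_nonneg w A o, fun U V hU hV => ?_⟩
  rw [sum_relayLaw_eq w A o (· ∈ U), sum_relayLaw_eq w A o (· ∈ V), sum_relayLaw_eq w A o (fun s => s ∈ U ∧ s ∈ V),
    sum_relayLaw_univ, one_mul]
  have hUup : IsUpperSet {ω : Set (Sym2 (Fin n)) | relaySet A o ω ∈ U} :=
    fun ω ω' h hω => hU (relaySet_mono A o h) hω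
  have hVup : IsUpperSet {ω : Set (Sym2 (Fin n)) | relaySet A o ω ∈ V} :=
    fun ω ω' h hω => hV (relaySet_mono A o h) hω
  have := prodBernoulli_harris w hUup hVup MeasurableSet.of_discrete MeasurableSet.of_discrete
  simpa [Set.setOf_and] using this

/-- Reach: `p(∅) = P(o ↮ A)`. -/
theorem relayLaw_empty :
    relayLaw w A o ∅ = 1 - (prodBernoulli w).real (⋃ a ∈ A, openConn o a) := by
  have hset : relaySet A o ⁻¹' {∅} = (⋃ a ∈ A, openConn o a)ᶜ := by
    ext ω
    simp only [Set.mem_preimage, Set.mem_singleton_iff, Set.mem_compl_iff, Set.mem_iUnion, exists_prop,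
      not_exists, not_and]
    constructor
    · intro h a ha hω
      have : (⟨a, ha⟩ : A) ∈ relaySet A o ω := (mem_relaySet A o ω ⟨a, ha⟩).2 hω
      rw [h] at this
      simp at this
    · intro h
      ext a
      simp only [mem_relaySet, Finset.notMem_empty, iff_false]
      exact h a a.2
  unfold relayLaw
  rw [hset, probReal_compl_eq_one_sub]
  exact MeasurableSet.of_discrete

/-- Pairs: discordance of two relays forces their disconnection. -/
theorem relayLaw_pair_le (i j : A) :
    (∑ s with ((i ∈ s ∧ j ∉ s) ∨ (j ∈ s ∧ i ∉ s)), relayLaw w A o s) ≤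
      1 - (prodBernoulli w).real (openConn (i : Fin n) (j : Fin n)) := by
  rw [sum_relayLaw_eq, ← probReal_compl_eq_one_sub (measurableSet_openConn_holds _ _)]
  refine measureReal_mono ?_
  intro ω hω hij
  have hij' : (openGraph ω).Reachable (i : Fin n) (j : Fin n) := hij
  simp only [Set.mem_setOf_eq, mem_relaySet] at hω
  rcases hω with ⟨hi, hj⟩ | ⟨hj, hi⟩
  · exact hj (show (openGraph ω).Reachable o j from (show (openGraph ω).Reachable o i from hi).trans hij')
  · exact hi (show (openGraph ω).Reachable o i from (show (openGraph ω).Reachable o j from hj).trans hij'.symm)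

/-- The mean: `Σ_i p(i ∈ S) = Σ_{a ∈ A} P(o ↔ a)`. -/
theorem relayLaw_mean :
    ∑ i : A, ∑ u with i ∈ u, relayLaw w A o u = ∑ a ∈ A, (prodBernoulli w).real (openConn o a) := by
  rw [← Finset.sum_coe_sort A]
  refine Finset.sum_congr rfl fun i _ => ?_
  rw [sum_relayLaw_eq]
  congr 1
  ext ω
  simp [mem_relaySet]

/-- The count: `|S| = #{a ∈ A : o ↔ a}`. -/
theorem card_relaySet (ω : Set (Sym2 (Fin n))) :
    (relaySet A o ω).card = (A.filter fun a => ω ∈ openConn o a).card := by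
  unfold relaySet
  rw [Finset.card_filter, Finset.card_filter, ← Finset.sum_coe_sort A]

end Perc

/-! ## The principle would imply the crux -/

/-- **Reduction.**  If the abstract indicator-law lower-tail principle held for some `C` and some
`ρ > 0`, the crux `NoHeavyLowerTail` would follow, with `δ := min (ρ ε) (ε / max C 1) / 2`: the law of
the relay set `S = {a ∈ A : o ↔ a}` under `prodBernoulli w` is positively associated (Harris), has
`p(S = ∅) = P(o ↮ A) < δ`, pair discordance `≤ P(a ↮ a') < δ`, and mean `Σ_a P(o ↔ a) = E N`. -/
theorem noHeavyLowerTail_of_indicatorLawLowerTail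
    (h : ∃ C ρ : ℝ, 0 < ρ ∧ IndicatorLawLowerTail C ρ) :
    Summit.CriticalPhenomena.PercolationContinuityZ3.Theses.PercNearOneGluing.NoHeavyLowerTail := by
  obtain ⟨C, ρ, hρ, hP⟩ := h
  intro ε hε
  set C' : ℝ := max C 1 with hC'def
  have hC'1 : 1 ≤ C' := le_max_right _ _
  have hC'0 : 0 < C' := lt_of_lt_of_le one_pos hC'1
  have hCC' : C ≤ C' := le_max_left _ _
  set δ : ℝ := min (ρ * ε) (ε / C') / 2 with hδdef
  have hmin_pos : 0 < min (ρ * ε) (ε / C') := lt_min (mul_pos hρ hε) (div_pos hε hC'0)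
  have hδ : 0 < δ := by rw [hδdef]; linarith
  have hδ1 : δ ≤ ρ * ε / 2 := by rw [hδdef]; linarith [min_le_left (ρ * ε) (ε / C')]
  have hδ2 : δ ≤ ε / C' / 2 := by rw [hδdef]; linarith [min_le_right (ρ * ε) (ε / C')]
  refine ⟨δ, hδ, ?_⟩
  intro n w A o hU hpair
  set μ := prodBernoulli w with hμ
  -- the principle applied to the relay law with `t = δ`
  have hreach : relayLaw w A o ∅ ≤ δ := by
    rw [relayLaw_empty]; linarith
  have hpairs : ∀ i j : A, i ≠ j →
      (∑ s with ((i ∈ s ∧ j ∉ s) ∨ (j ∈ s ∧ i ∉ s)), relayLaw w A o s) ≤ δ := by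
    intro i j _
    refine (relayLaw_pair_le w A o i j).trans ?_
    linarith [hpair i i.2 j j.2]
  have key := hP A (relayLaw w A o) (isPosAssocLaw_relayLaw w A o) (sum_relayLaw_univ w A o) δ hδ.le
    hreach hpairs
  rw [relayLaw_mean, sum_relayLaw_eq] at key
  -- the crux event lies inside the principle's bad event
  have hEN : 0 ≤ ∑ a ∈ A, μ.real (openConn o a) := Finset.sum_nonneg fun a _ => measureReal_nonneg
  have hratio : δ / ε ≤ ρ := by
    rw [div_le_iff₀ hε]; nlinarith
  have hsub : {ω : Set (Sym2 (Fin n)) | 1 ≤ (A.filter fun a => ω ∈ openConn o a).card ∧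
        ((A.filter fun a => ω ∈ openConn o a).card : ℝ) <
          δ * (∑ a ∈ A, μ.real (openConn o a)) / ε} ⊆
      {ω | 1 ≤ (relaySet A o ω).card ∧
        ((relaySet A o ω).card : ℝ) < ρ * ∑ a ∈ A, μ.real (openConn o a)} := by
    rintro ω ⟨h1, h2⟩
    rw [Set.mem_setOf_eq, card_relaySet]
    refine ⟨h1, lt_of_lt_of_le h2 ?_⟩
    calc δ * (∑ a ∈ A, μ.real (openConn o a)) / ε
        = (δ / ε) * (∑ a ∈ A, μ.real (openConn o a)) := by ring
      _ ≤ ρ * (∑ a ∈ A, μ.real (openConn o a)) := mul_le_mul_of_nonneg_right hratio hEN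
  calc μ.real {ω : Set (Sym2 (Fin n)) | 1 ≤ (A.filter fun a => ω ∈ openConn o a).card ∧
          ((A.filter fun a => ω ∈ openConn o a).card : ℝ) <
            δ * (∑ a ∈ A, μ.real (openConn o a)) / ε}
      ≤ μ.real {ω | 1 ≤ (relaySet A o ω).card ∧
        ((relaySet A o ω).card : ℝ) < ρ * ∑ a ∈ A, μ.real (openConn o a)} := measureReal_mono hsub
    _ ≤ C * δ := key
    _ ≤ C' * δ := mul_le_mul_of_nonneg_right hCC' hδ.le
    _ ≤ ε / 2 := by
        calc C' * δ ≤ C' * (ε / C' / 2) := mul_le_mul_of_nonneg_left hδ2 hC'0.le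
          _ = ε / 2 := by field_simp
    _ < ε := by linarith

/-- The same reduction for this sibling route's (definitionally identical) decl. -/
theorem noHeavyLowerTail_of_indicatorLawLowerTail'
    (h : ∃ C ρ : ℝ, 0 < ρ ∧ IndicatorLawLowerTail C ρ) :
    Summit.CriticalPhenomena.PercolationContinuityZ3.Theses.PercNearOneGluingNoHeavy.NoHeavyLowerTail :=
  noHeavyLowerTail_of_indicatorLawLowerTail h

/-- **Reduction, ε–δ form.**  If the ε–δ principle `IndicatorLawLowerTailED` held, the crux `NoHeavyLowerTail` would follow
with the SAME `δ(ε)`: apply it to the law of the relay set. [this file] -/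
theorem noHeavyLowerTail_of_indicatorLawLowerTailED (h : IndicatorLawLowerTailED) :
    Summit.CriticalPhenomena.PercolationContinuityZ3.Theses.PercNearOneGluing.NoHeavyLowerTail := by
  intro ε hε
  obtain ⟨δ, hδ, hP⟩ := h ε hε
  refine ⟨δ, hδ, ?_⟩
  intro n w A o hU hpair
  have hreach : relayLaw w A o ∅ ≤ δ := by
    rw [relayLaw_empty]; linarith
  have hpairs : ∀ i j : A, i ≠ j →
      (∑ s with ((i ∈ s ∧ j ∉ s) ∨ (j ∈ s ∧ i ∉ s)), relayLaw w A o s) ≤ δ := by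
    intro i j _
    refine (relayLaw_pair_le w A o i j).trans ?_
    linarith [hpair i i.2 j j.2]
  have key := hP A (relayLaw w A o) (isPosAssocLaw_relayLaw w A o) (sum_relayLaw_univ w A o) hreach hpairs
  rw [relayLaw_mean, sum_relayLaw_eq] at key
  have hset : {ω : Set (Sym2 (Fin n)) | 1 ≤ (A.filter fun a => ω ∈ openConn o a).card ∧
        ((A.filter fun a => ω ∈ openConn o a).card : ℝ) <
          δ * (∑ a ∈ A, (prodBernoulli w).real (openConn o a)) / ε} =
      {ω | 1 ≤ (relaySet A o ω).card ∧
        ((relaySet A o ω).card : ℝ) < δ * (∑ a ∈ A, (prodBernoulli w).real (openConn o a)) / ε} := by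
    ext ω; simp only [Set.mem_setOf_eq, card_relaySet]
  rw [hset]
  exact key

/-- The ε–δ reduction for this sibling route's (definitionally identical) decl. -/
theorem noHeavyLowerTail_of_indicatorLawLowerTailED' (h : IndicatorLawLowerTailED) :
    Summit.CriticalPhenomena.PercolationContinuityZ3.Theses.PercNearOneGluingNoHeavy.NoHeavyLowerTail :=
  noHeavyLowerTail_of_indicatorLawLowerTailED h

end Summit.CriticalPhenomena.PercolationContinuityZ3.Theorems
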